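import Literature.Computability.MetaComplexity.ProofSystemsTautProofs
import HarnessLib

/-!
# Frege systems are Cook–Reckhow proof systems: discharge of `exists_isProofSystemFor_of_isFrege`

Sibling proof file of `Frege.lean` (D-0014). It discharges
`Literature.Computability.MetaComplexity.exists_isProofSystemFor_of_isFrege_holds`: for every
Frege system `F` there is a verifier-form Cook–Reckhow proof system `V` for `TAUT` which is
polynomially bounded **iff** `F` is.

## Source and printed argument

S. A. Cook, R. A. Reckhow, *The relative efficiency of propositional proof systems*,
J. Symbolic Logic 44 (1979) 36–50. Closing remark of §1 (pp. 39–40): "any conventional proof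
system for tautologies can naturally be made to fit the definition of proof system in 1.3 …
an atom itself must be regarded as a string (say the letter P followed by a string over
`{0, 1}`) … a proof `π` … can naturally be regarded as a string … `f(π) = A` if `π` proves
`A`, and `f(π) = A₀` for some fixed tautology `A₀` if `π` is a string not corresponding to a
proof"; p. 37 ("this verification can be performed within time bounded by some polynomial in
`n`"); §2, Def. 2.1–2.2 (Frege rules, derivations, Frege systems), Lemma 2.5 ("If `π` is a
derivation of `A` from `B₁, …, B_k` in a Frege system `𝓕`, then `σ(π)` is a derivation of
`σA` from `σB₁, …, σB_k` in `𝓕`, for any substitution `σ`"), Cor. 2.4 ("one Frege system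
over `κ` is polynomially bounded iff all Frege systems over `κ` are").

## The witness and what is proved here

`V = tautVerifier FregeVerifier.verifier` (`ProofComplexityNP.lean`): the codeword test AND
the string checker of pool-annotated `textbookFrege` proofs
(`FregeVerifier{Model,Complete,Bricks,Machine}.lean`; polynomial time, sound, complete with
polynomial overhead). By Cor. 2.4 in the tree (`isPolyBounded_iff_of_isFrege_holds`,
`isFrege_textbookFrege_holds`) it suffices to compare `V` with `textbookFrege`;
"`textbookFrege` polynomially bounded ⇒ `V` polynomially bounded" repeats the argument of
`hasPolyBoundedProofSystem_TAUT_of_verifier` for the concrete `V`. NEW is the converse, by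
PROOF EXTRACTION with a size bound plus a renaming:

1. (`linesDer_cons`, `run_der`) the soundness invariant of the model checker strengthened
   from "lines are codes of tautologies" to "lines are the codes of formulas `ψ₁, …, ψ_n` over
   bit-string atoms whose relabellings `ψ_i.mapVars decodeNat` form a `textbookFrege`
   derivation" (a rule item instantiates a rule by certified codes, Def. 2.1; relabelling
   commutes with instantiation, `substL_mapVars`, the derivation-level form of Lemma 2.5);
2. (`linesLen_stepModel`, `linesLen_run_quad`) a rule item adds one line, the string instance
   of a conclusion of `≤ 12` nodes in which each metavariable occurs at most twice, so the
   lines have total length `≤ 37 |c|` for a certificate `c`; nodes `≤` bits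
   (`size_le_length_scode`);
3. (`verifier_extract`) an accepted certificate `c` for the codeword of `φ` yields a
   `textbookFrege`-proof of `φ` (the last line is `φ.code = scode (φ.mapVars encodeNat)` and
   `decodeNat ∘ encodeNat = id`) with `proofSize ≤ 37 |c|`;
4. (`textbookFrege_isPolyBounded_of_isPolyBounded`) given `V` polynomially bounded by `p` and
   a tautology `φ`, rename its atoms injectively into `0, …, |φ| - 1` (Lemma 2.5;
   `FregeSystem.exists_renaming`, `IsProofOf.map_subst`), so that the codeword has length
   `≤ 2|φ| + 2 + (6 + 2|φ|)|φ|` although `φ.size` ignores the binary atom indices; take a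
   short accepted certificate, extract, rename back (same `proofSize`): `textbookFrege` is
   polynomially bounded by `37 · p(2X + 2 + (6 + 2X)X)`.
-/

namespace Literature.Computability.MetaComplexity

open _root_.Computability Complexity Complexity.Brick Polynomial

namespace FregeVerifier

/-! ### Relabelling string-level formulas into formulas over `ℕ` -/

/-- Relabelling an instantiated template is instantiating the template by the relabelled
formulas (the derivation-level form of Cook–Reckhow's Lemma 2.5: substitution instances are
preserved under renaming of atoms). [cite: CookReckhow1979, Lemma 2.5] -/
theorem substL_mapVars (g : List Bool → ℕ) (θ : ℕ → PropForm (List Bool)) (T : PropForm ℕ) :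
    (substL θ T).mapVars g = T.subst fun i => (θ i).mapVars g := by
  induction T <;> simp_all [substL, PropForm.mapVars, PropForm.subst]

/-- Every node of a formula over bit-string variables contributes at least one bit to its
code. [folklore] -/
theorem size_le_length_scode (ψ : PropForm (List Bool)) : ψ.size ≤ (scode ψ).length := by
  induction ψ with
  | var bs => simp only [PropForm.size, scode, List.length_cons]; omega
  | const b => simp [PropForm.size, scode]
  | neg θ ih => simp only [PropForm.size, scode, List.length_cons]; omega
  | conj θ ψ ih₁ ih₂ =>
    simp only [PropForm.size, scode, List.length_cons, List.length_append]; omega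
  | disj θ ψ ih₁ ih₂ =>
    simp only [PropForm.size, scode, List.length_cons, List.length_append]; omega

/-! ### The derivation invariant of the model checker -/

/-- **The derivation invariant** (strengthening `LinesInv`: the derived strings, most recent
first, are the codes of formulas over bit-string atoms whose relabellings by `decodeNat` form
a `textbookFrege`-derivation from no hypotheses) **is preserved by a successful rule item**:
the new line is the instance of the conclusion by the certified codes `s 0, s 1, s 2`
(`sfill_eq_scode`), the premise instances occur among the earlier lines (`scode_injective`),
and relabelling commutes with instantiation (`substL_mapVars`).
[cite: CookReckhow1979, §2 Def. 2.1 ("σD follows from σC₁, …, σCₙ by the rule")] -/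
theorem linesDer_cons {r : FregeRule} (hr : r ∈ textbookFrege.rules) {s : ℕ → List Bool}
    {lines pool : List (List Bool)} (hP : PoolInv pool)
    (hL : ∃ π : List (PropForm (List Bool)), lines = (π.map scode).reverse ∧
      textbookFrege.IsDerivation ∅ (π.map (PropForm.mapVars decodeNat)))
    (hok : ruleOk r s lines pool = true) :
    ∃ π : List (PropForm (List Bool)), sfill s r.conclusion :: lines = (π.map scode).reverse ∧
      textbookFrege.IsDerivation ∅ (π.map (PropForm.mapVars decodeNat)) := by
  simp only [ruleOk, Bool.and_eq_true, List.all_eq_true, decide_eq_true_eq] at hok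
  obtain ⟨hprem, h0, h1, h2⟩ := hok
  obtain ⟨θ0, hθ0⟩ := hP _ h0
  obtain ⟨θ1, hθ1⟩ := hP _ h1
  obtain ⟨θ2, hθ2⟩ := hP _ h2
  -- the formula substitution read off the certified strings
  let θ : ℕ → PropForm (List Bool) := fun i =>
    match i with | 0 => θ0 | 1 => θ1 | 2 => θ2 | _ => .const true
  have hsθ : ∀ p ∈ r.conclusion :: r.premises, sfill s p = scode (substL θ p) := by
    intro p hp
    refine sfill_eq_scode p fun i hi => ?_
    have hi3 := vars_lt_three_of_mem_rules hr p hp i hi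
    match i, hi3 with
    | 0, _ => exact hθ0
    | 1, _ => exact hθ1
    | 2, _ => exact hθ2
  obtain ⟨π, rfl, hder⟩ := hL
  refine ⟨π ++ [substL θ r.conclusion], by simp [hsθ _ (List.mem_cons_self ..)], ?_⟩
  rw [List.map_append, List.map_singleton]
  refine hder.snoc (Or.inr ⟨r, hr, fun i => (θ i).mapVars decodeNat,
    (substL_mapVars _ _ _).symm, fun p hp => ?_⟩)
  have hpl : sfill s p ∈ (π.map scode).reverse := hprem p hp
  rw [hsθ p (List.mem_cons_of_mem _ hp), List.mem_reverse, List.mem_map] at hpl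
  obtain ⟨χ, hχ, hχe⟩ := hpl
  rw [← substL_mapVars, ← scode_injective hχe]
  exact List.mem_map_of_mem hχ

/-- **The invariants are preserved by a step** (pool codes and the derivation invariant), as
long as the verdict stays `true`. [folklore] -/
theorem stepModel_der (kind a b c : List Bool) (st : MState)
    (hinv : st.ok = true → PoolInv st.pool ∧ ∃ π : List (PropForm (List Bool)),
      st.lines = (π.map scode).reverse ∧
        textbookFrege.IsDerivation ∅ (π.map (PropForm.mapVars decodeNat))) :
    (stepModel kind a b c st).ok = true →
      PoolInv (stepModel kind a b c st).pool ∧ ∃ π : List (PropForm (List Bool)),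
        (stepModel kind a b c st).lines = (π.map scode).reverse ∧
          textbookFrege.IsDerivation ∅ (π.map (PropForm.mapVars decodeNat)) := by
  intro hok
  unfold stepModel at hok ⊢
  split at hok
  · rename_i n _
    unfold applyKind at hok ⊢
    split at hok
    · rename_i hn
      rw [if_pos hn]
      simp only [Bool.and_eq_true] at hok
      obtain ⟨hP, hL⟩ := hinv hok.1
      exact ⟨poolInv_cons hP hok.2, hL⟩
    · rename_i hn
      rw [if_neg hn]
      split at hok
      · rename_i r hr
        simp only [Bool.and_eq_true] at hok
        obtain ⟨hP, hL⟩ := hinv hok.1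
        have hmem : r ∈ textbookFrege.rules := List.mem_of_getElem? hr
        exact ⟨hP, linesDer_cons hmem hP hL hok.2⟩
      · simp at hok
  · simp at hok

/-- **The derivation invariant of a run**: from a good state, if the verdict is `true` then the
derived lines read back as a `textbookFrege`-derivation. [folklore] -/
theorem run_der (items : List Item) (st : MState)
    (hinv : st.ok = true → PoolInv st.pool ∧ ∃ π : List (PropForm (List Bool)),
      st.lines = (π.map scode).reverse ∧
        textbookFrege.IsDerivation ∅ (π.map (PropForm.mapVars decodeNat))) :
    (run items st).ok = true → PoolInv (run items st).pool ∧ ∃ π : List (PropForm (List Bool)),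
      (run items st).lines = (π.map scode).reverse ∧
        textbookFrege.IsDerivation ∅ (π.map (PropForm.mapVars decodeNat)) := by
  induction items generalizing st with
  | nil => exact hinv
  | cons i items ih =>
    obtain ⟨k, a, b, c⟩ := i
    exact ih _ (stepModel_der k a b c st hinv)

/-! ### The total length of the derived lines -/

/-- One step adds at most `36 + 2 (|a| + |b| + |c|)` bits to the total length of the lines: a
rule conclusion has at most `12` nodes, three bits each, and each metavariable occurs at most
twice in it (`length_sfill_le`, `size_conclusion_le`, `sum_varList_conclusion_le`). [folklore] -/
theorem linesLen_stepModel (kind a b c : List Bool) (st : MState) :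
    ((stepModel kind a b c st).lines.map List.length).sum ≤
      (st.lines.map List.length).sum + (36 + 2 * (a.length + b.length + c.length)) := by
  unfold stepModel
  split
  · rename_i n _
    unfold applyKind
    split
    · exact Nat.le_add_right _ _
    · split
      · rename_i r hr
        have hmem : r ∈ textbookFrege.rules := List.mem_of_getElem? hr
        have h1 := length_sfill_le (sv a b c) r.conclusion
        have h2 : (r.conclusion.varList.map fun i => (sv a b c i).length).sum ≤
            2 * (a.length + b.length + c.length) := sum_varList_conclusion_le hmem (sv a b c)
        have h3 := size_conclusion_le hmem
        simp only [List.map_cons, List.sum_cons]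
        omega
      · exact Nat.le_add_right _ _
  · exact Nat.le_add_right _ _

/-- **Running over the items read from item strings `l` adds at most `36 |l| + Σ_{a ∈ l} 2|a|`
bits of lines** (the three payloads are fields `1, 2, 3` of the record `a`,
`two_mul_fields_le`). [folklore] -/
theorem linesLen_run_quad (l : List (List Bool)) (st : MState) :
    ((run (l.map quad) st).lines.map List.length).sum ≤
      (st.lines.map List.length).sum + 36 * l.length + (l.map fun a => 2 * a.length).sum := by
  induction l generalizing st with
  | nil => simp [run]
  | cons a l ih =>
    have h := linesLen_stepModel (nthF 0 a) (nthF 1 a) (nthF 2 a) (nthF 3 a) st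
    have hq : 2 * ((nthF 1 a).length + (nthF 2 a).length + (nthF 3 a).length) ≤ a.length := by
      have h1 := two_mul_fields_le (sndF a)
      have h2 := length_fstF_sndF_le a
      exact h1.trans (by omega)
    have h' := ih (stepModel (nthF 0 a) (nthF 1 a) (nthF 2 a) (nthF 3 a) st)
    simp only [List.map_cons, List.length_cons, List.sum_cons]
    show ((run (l.map quad) (stepModel (nthF 0 a) (nthF 1 a) (nthF 2 a) (nthF 3 a) st)).lines.map
      List.length).sum ≤ _
    omega

/-! ### Proof extraction -/

/-- The relabelled derivation read off the lines is no larger than the total length of the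
lines. [folklore] -/
theorem proofSize_map_mapVars_le (π : List (PropForm (List Bool))) :
    proofSize (π.map (PropForm.mapVars decodeNat)) ≤ ((π.map scode).map List.length).sum := by
  induction π with
  | nil => simp [proofSize]
  | cons ψ π ih =>
    have := size_le_length_scode ψ
    simp only [proofSize, List.map_cons, List.sum_cons, PropForm.size_mapVars] at ih ⊢
    omega

/-- **Proof extraction (model level).** If a run from the initial state ends with verdict
`true` and most recent line `φ.code`, then `φ` has a `textbookFrege`-proof no larger than the
total length of the lines: they read back as a derivation over bit-string atoms (`run_der`),
relabelled by `decodeNat` into one over `ℕ` ending in `(φ.mapVars encodeNat).mapVars decodeNat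
= φ`. [cite: CookReckhow1979, §1 (closing remark: "f(π) = A if π proves A") and §2 Def. 2.1–2.2] -/
theorem exists_isProofOf_of_run (items : List Item) (φ : PropForm ℕ)
    (hok : (run items init).ok = true) (hlast : (run items init).lines.head? = some φ.code) :
    ∃ π, textbookFrege.IsProofOf π φ ∧
      proofSize π ≤ ((run items init).lines.map List.length).sum := by
  obtain ⟨-, πs, hlines, hder⟩ := run_der items init (fun _ => ⟨fun e he => by simp [init] at he,
    [], rfl, FregeSystem.isDerivation_nil _ _⟩) hok
  rw [hlines] at hlast ⊢
  rw [List.head?_reverse, List.getLast?_map] at hlast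
  cases hl : πs.getLast? with
  | none => rw [hl] at hlast; simp at hlast
  | some ψ =>
    rw [hl, Option.map_some, Option.some.injEq, code_eq_scode] at hlast
    have hψ : ψ = φ.mapVars encodeNat := scode_injective hlast
    refine ⟨πs.map (PropForm.mapVars decodeNat), ⟨hder, ?_⟩, ?_⟩
    · have hid : (decodeNat ∘ encodeNat : ℕ → ℕ) = id := funext decode_encodeNat
      rw [List.getLast?_map, hl, Option.map_some, hψ, PropForm.mapVars_mapVars, hid,
        PropForm.mapVars_id]
    · rw [List.map_reverse, List.sum_reverse]
      exact proofSize_map_mapVars_le πs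

/-- **Proof extraction (verifier level).** An accepted certificate `c` for the codeword of `φ`
yields a `textbookFrege`-proof of `φ` of size at most `37 |c|`.
[cite: CookReckhow1979, §1 (closing remark) and §2 Def. 2.1–2.2] -/
theorem verifier_extract (φ : PropForm ℕ) (c : List Bool)
    (h : verifier (encodingPropForm.encode φ) c = true) :
    ∃ π, textbookFrege.IsProofOf π φ ∧ proofSize π ≤ 37 * c.length := by
  simp only [verifier, decide_eq_true_eq, fregeVerdictF_apply, List.cons.injEq, and_true,
    Bool.and_eq_true, decide_eq_true_eq] at h
  obtain ⟨hok, hlast⟩ := h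
  rw [fstF_boolPair, sndF_encode] at hlast
  rw [sndF_boolPair] at hok hlast
  have hhead : (run ((decNil c).map quad) init).lines.head? = some φ.code := by
    cases hl : (run ((decNil c).map quad) init).lines with
    | nil =>
      rw [hl] at hlast
      exact absurd hlast.symm (by rw [encList_nil]; exact code_ne_nil φ)
    | cons L rest => rw [hl, fstF_encList_cons] at hlast; simp [hlast]
  obtain ⟨π, hπ, hsize⟩ := exists_isProofOf_of_run _ φ hok hhead
  have h1 := linesLen_run_quad (decNil c) init
  have h2 := length_decNil_le c
  have h3 := sum_decNil_le c
  refine ⟨π, hπ, hsize.trans (h1.trans ?_)⟩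
  simp only [init, List.map_nil, List.sum_nil]
  omega

/-! ### Polynomial boundedness of the combined verifier `tautVerifier verifier` -/

/-- What the combined verifier accepts: codewords of tautologies (codeword test
`mem_range_encode_of_chkTaut_nil`, soundness `verifier_sound`). [cite: CookReckhow1979, §1 (closing remark)] -/
theorem exists_of_tautVerifier {w c : List Bool} (h : tautVerifier verifier w c = true) :
    ∃ φ : PropForm ℕ, w = encodingPropForm.encode φ ∧ φ.IsTautology := by
  simp only [tautVerifier, Bool.and_eq_true, Bool.not_eq_true'] at h
  obtain ⟨φ, rfl⟩ := mem_range_encode_of_chkTaut_nil h.1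
  exact ⟨φ, rfl, verifier_sound φ c h.2⟩

/-- Every `textbookFrege`-proof of `φ` yields a certificate accepted by the combined verifier
for the codeword of `φ`, of length at most `100 (proofSize π + |encode φ| + 2)^4`
(`verifier_complete`; the codeword test passes by soundness). [cite: CookReckhow1979, §1 (closing remark)] -/
theorem exists_tautVerifier_of_isProofOf {φ : PropForm ℕ} {π : List (PropForm ℕ)}
    (h : textbookFrege.IsProofOf π φ) :
    ∃ c : List Bool, c.length ≤ (100 * (X + 2) ^ 4 : Polynomial ℕ).eval
        (proofSize π + (encodingPropForm.encode φ).length) ∧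
      tautVerifier verifier (encodingPropForm.encode φ) c = true := by
  obtain ⟨c, hc, hV⟩ := verifier_complete φ π h
  have hφ : φ.IsTautology := isSound_textbookFrege.isTautology_of_isProofOf h
  have h0 := chkTaut_nil_eq_false_of_mem_TAUT ((mem_TAUT_iff φ).2 hφ)
  exact ⟨c, hc, by simp [tautVerifier, h0, hV]⟩

/-- If `textbookFrege` is polynomially bounded then so is the combined verifier: an accepted
pair concerns the codeword of a tautology `φ`, which has a proof of size `≤ p(φ.size) ≤
p(|encode φ|)`, hence an accepted certificate of length `≤ 100 (p(|encode φ|) + |encode φ| + 2)^4`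
(the argument of `hasPolyBoundedProofSystem_TAUT_of_verifier`). [cite: CookReckhow1979, §1 (Def. 1.3, closing remark)] -/
theorem isPolyBounded_tautVerifier_of_isPolyBounded (hpb : textbookFrege.IsPolyBounded) :
    IsPolyBounded (tautVerifier verifier) := by
  obtain ⟨p, hp⟩ := hpb
  refine ⟨(100 * (X + 2) ^ 4 : Polynomial ℕ).comp (p + X), fun w c h => ?_⟩
  obtain ⟨φ, rfl, hφ⟩ := exists_of_tautVerifier h
  obtain ⟨π, hπ, hsize⟩ := hp φ hφ
  obtain ⟨c', hc', hV⟩ := exists_tautVerifier_of_isProofOf hπ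
  refine ⟨c', hc'.trans ?_, hV⟩
  rw [eval_comp, eval_add, eval_X]
  exact natPoly_eval_mono _ (Nat.add_le_add_right
    (hsize.trans (natPoly_eval_mono p (size_le_length_encode φ))) _)

/-- **If the combined verifier is polynomially bounded then so is `textbookFrege`.** Rename
the atoms of a tautology `φ` injectively into `0, …, |φ| - 1` (Lemma 2.5;
`FregeSystem.exists_renaming`): same size, codeword of length `≤ 2|φ| + 2 + (6 + 2|φ|)|φ|`
(`PropForm.length_code_le`); by completeness it has an accepted certificate, hence one of
length `≤ p(|encode φ₁|)`, from which `verifier_extract` gives a proof of `φ₁` of size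
`≤ 37 p(|encode φ₁|)`; rename back (`IsProofOf.map_subst`, `PropForm.subst_var_subst_var`).
[cite: CookReckhow1979, §1 (closing remark) with Lemma 2.5] -/
theorem textbookFrege_isPolyBounded_of_isPolyBounded
    (h : IsPolyBounded (tautVerifier verifier)) : textbookFrege.IsPolyBounded := by
  obtain ⟨p, hp⟩ := h
  refine ⟨C 37 * p.comp (C 2 * X + C 2 + (C 6 + C 2 * X) * X), fun φ hφ => ?_⟩
  -- rename the atoms of `φ` into an initial segment
  obtain ⟨g, g', hg, hg'⟩ := FregeSystem.exists_renaming φ.vars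
  have hφ₁ : (φ.subst fun x => PropForm.var (g x)).IsTautology := hφ.subst _
  have hsz : (φ.subst fun x => PropForm.var (g x)).size = φ.size := PropForm.size_subst_var g φ
  have hvars : ∀ x ∈ (φ.subst fun x => PropForm.var (g x)).vars, x ≤ φ.size := by
    intro x hx
    rw [PropForm.vars_subst_var, Finset.mem_image] at hx
    obtain ⟨y, hy, rfl⟩ := hx
    exact ((hg y hy).trans_le (PropForm.card_vars_le_size φ)).le
  have henc : (encodingPropForm.encode (φ.subst fun x => PropForm.var (g x))).length ≤
      2 * φ.size + 2 + (6 + 2 * φ.size) * φ.size := by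
    have hcode := PropForm.length_code_le _ hvars
    rw [hsz] at hcode
    rw [length_encode_propForm, hsz]
    exact Nat.add_le_add_left hcode _
  -- a short accepted certificate for the renamed tautology, and the extracted proof
  obtain ⟨π₁, hπ₁⟩ :=
    (FregeSystem.provable_iff_isTautology isFrege_textbookFrege_holds).2 hφ₁
  obtain ⟨c, -, hc⟩ := exists_tautVerifier_of_isProofOf hπ₁
  obtain ⟨c', hc'len, hc'⟩ := hp _ _ hc
  simp only [tautVerifier, Bool.and_eq_true] at hc'
  obtain ⟨π₂, hπ₂, hsize₂⟩ := verifier_extract _ c' hc'.2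
  -- rename back
  have hπ := hπ₂.map_subst fun y => PropForm.var (g' y)
  rw [PropForm.subst_var_subst_var (fun x hx => hg' x hx)] at hπ
  refine ⟨_, hπ, ?_⟩
  rw [FregeSystem.proofSize_map_subst_var]
  refine hsize₂.trans
    ((Nat.mul_le_mul_left 37 (hc'len.trans (natPoly_eval_mono p henc))).trans_eq ?_)
  simp only [eval_mul, eval_C, eval_comp, eval_add, eval_X]

end FregeVerifier

/-! ### Discharge -/

/-- **Discharge of `exists_isProofSystemFor_of_isFrege`** (Cook–Reckhow 1979, closing remark
of §1 with §2, Cor. 2.4 and Lemma 2.5): for a Frege system `F`, the combined verifier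
`tautVerifier FregeVerifier.verifier` is a Cook–Reckhow proof system for `TAUT`
(`isProofSystemFor_tautVerifier` of `ProofSystemsTautProofs.lean`, fed with
`isPolyTimeVerifier_verifier`, `verifier_sound`, `verifier_complete`), and it is polynomially
bounded iff `textbookFrege` is (`FregeVerifier.isPolyBounded_tautVerifier_of_isPolyBounded`,
`FregeVerifier.textbookFrege_isPolyBounded_of_isPolyBounded`) iff `F` is (Cor. 2.4,
`isPolyBounded_iff_of_isFrege_holds` with `isFrege_textbookFrege_holds`).
[cite: CookReckhow1979, §1 (closing remark: conventional proof systems fit Def. 1.3) and §2 Cor. 2.4, Lemma 2.5] -/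
theorem exists_isProofSystemFor_of_isFrege_holds : exists_isProofSystemFor_of_isFrege := by
  intro F hF
  refine ⟨tautVerifier FregeVerifier.verifier, isProofSystemFor_tautVerifier
    FregeVerifier.isPolyTimeVerifier_verifier FregeVerifier.verifier_sound fun φ π hπ =>
      (FregeVerifier.verifier_complete φ π hπ).imp fun _ h => h.2, ?_⟩
  have hiff : F.IsPolyBounded ↔ textbookFrege.IsPolyBounded :=
    isPolyBounded_iff_of_isFrege_holds hF isFrege_textbookFrege_holds
  rw [hiff]
  exact ⟨FregeVerifier.textbookFrege_isPolyBounded_of_isPolyBounded,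
    FregeVerifier.isPolyBounded_tautVerifier_of_isPolyBounded⟩

end Literature.Computability.MetaComplexity
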